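import Summits.PneNP.PneNP.Theorems.ConvexRankGatesConvexGateBlindExactLiftingTriangleIsolationKernelTwo

/-!
# Triangle instance — line isolation, file 5: the averaged identity `A + B + C = −4ε M` and the bounds on `A, B, C`

Support file for crux `ConvexGateBlind` (stmt-PneNP-10680), open stub `stub_exactLifting`; prover seat 0, session 22,
memo ANALYSIS12 (Theorem B, §2.1–2.2). A LINE-LABELLED FACTORISATION of `M_t − εJ` (`IsLineFact`): row functions
`u L x ≥ 0`, column functions `v L w ≥ 0` indexed by the `3t²` lines, `∑_L u L x · v L w = monoCount x w − ε`, each `v L`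
of mean `1` on its own line, and the rows `η`-close to the line pattern: `|u L x − [L mono under x]| ≤ η`.
Writing `u = [mono] + E`, `v = 1_L + Δ` (`E` small, `E ≥ 0` on bichromatic lines; `Δ ≥ 0` off the line, `∑_{L} Δ = 0`):
* (★) `∑_L [mono] Δ_L(w) + ∑_L E_L(x) 1_L(w) + ∑_L E_L(x) Δ_L(w) = −ε` for all `x, w` (`star`);
* applying the cube functional `ψ^x` and summing over all `x`:  `A + B + C = −4ε·M` (`identity`) with
  `A = ∑_L ∑_w ker L w · Δ_L(w)`, `B = ∑_x ∑_L E_L(x) ψ^x(1_L) ≥ 0`, `C = ∑_x ∑_L E_L(x) ψ^x(Δ_L)`, `M = ∑_x μ(x)`;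
* the bounds `Kmin · S₁ ≤ 128 A` (kernel sign-definiteness; `S₁` = off-line mass of `Δ`), `2 B̃ ≤ t² B`
  (`B̃ = ∑_x μ(x) ∑_{L bichro} E_L(x)`), `|C| ≤ η · Fd³ · (S₁ + S_on)` (`S_on` = on-line `ℓ¹` mass of `Δ`).
-/

set_option linter.dupNamespace false -- `Summit.PneNP.PneNP.…`: summit = sub-problem (D-0017)

namespace Summit.PneNP.PneNP.Theorems.XorDoor.TriLine

open Finset

noncomputable section

variable {t : ℕ}

/-! ## Line indicators -/

/-- `0 ≤ 1_L` -/
lemma lind_nonneg (L : Line t) (w : Tri t) : 0 ≤ lind L w := by unfold lind; split_ifs <;> norm_num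
/-- `1_L ≤ 1` -/
lemma lind_le_one (L : Line t) (w : Tri t) : lind L w ≤ 1 := by unfold lind; split_ifs <;> norm_num
/-- `1_L = 1` on the line -/
lemma lind_of_lmem {L : Line t} {w : Tri t} (h : lmem L w) : lind L w = 1 := if_pos h
/-- `1_L = 0` off the line -/
lemma lind_of_not_lmem {L : Line t} {w : Tri t} (h : ¬ lmem L w) : lind L w = 0 := if_neg h

/-- a line has `t` points -/
lemma sum_lind (L : Line t) : ∑ w : Tri t, lind L w = t := by
  have h3 : ∀ p q : Fin t, ∑ w : Tri t, (if w.1 = p ∧ w.2.1 = q then (1 : ℝ) else 0) = t := by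
    intro p q
    rw [Fintype.sum_prod_type, Fintype.sum_eq_single p, Fintype.sum_prod_type, Fintype.sum_eq_single q]
    · simp
    · intro q' hq'; exact sum_eq_zero fun d _ => by simp [hq']
    · intro p' hp'; exact sum_eq_zero fun qd _ => by simp [hp']
  rcases L with ⟨a, b⟩ | ⟨a, d⟩ | ⟨b, d⟩
  · unfold lind; simp only [lmem_inl]; exact h3 a b
  · calc ∑ w : Tri t, lind (Sum.inr (Sum.inl (a, d))) w = ∑ w : Tri t, lind (Sum.inl (a, d)) (swT w) := by
          simp only [lind_inl_swT]
      _ = ∑ w : Tri t, lind (Sum.inl (a, d)) w :=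
          Fintype.sum_bijective swT swT_involutive.bijective _ _ fun _ => rfl
      _ = t := by unfold lind; simp only [lmem_inl]; exact h3 a d
  · calc ∑ w : Tri t, lind (Sum.inr (Sum.inr (b, d))) w = ∑ w : Tri t, lind (Sum.inl (b, d)) (cyT w) := by
          simp only [lind_inl_cyT]
      _ = ∑ w : Tri t, lind (Sum.inl (b, d)) w :=
          Fintype.sum_bijective cyT cyT_bijective _ _ fun _ => rfl
      _ = t := by unfold lind; simp only [lmem_inl]; exact h3 b d

/-- a triangle lies on `3` lines -/
lemma sum_lind_point (w : Tri t) : ∑ L : Line t, lind L w = 3 := by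
  obtain ⟨a, b, d⟩ := w
  have h1 : ∀ p q : Fin t, ∑ pq : Fin t × Fin t, (if p = pq.1 ∧ q = pq.2 then (1 : ℝ) else 0) = 1 := by
    intro p q
    rw [Fintype.sum_eq_single (p, q)]
    · simp
    · rintro ⟨p', q'⟩ h
      rw [if_neg]
      rintro ⟨hp, hq⟩
      exact h (by rw [hp, hq])
  unfold lind
  rw [Fintype.sum_sum_type, Fintype.sum_sum_type]
  simp only [lmem_inl, lmem_inr_inl, lmem_inr_inr, h1]
  norm_num

/-! ## Line-labelled factorisations near the line pattern -/

/-- the line pattern of the rows: `[L monochromatic under x]` -/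
def mInd (x : Col t) (L : Line t) : ℝ := if lmono x L then 1 else 0

/-- A LINE-LABELLED FACTORISATION of `M_t − εJ` with normalised columns and rows `η`-close to the line pattern. -/
structure IsLineFact (t : ℕ) (ε η : ℝ) (u : Line t → Col t → ℝ) (v : Line t → Tri t → ℝ) : Prop where
  u_nonneg : ∀ L x, 0 ≤ u L x
  v_nonneg : ∀ L w, 0 ≤ v L w
  fact : ∀ x w, ∑ L, u L x * v L w = (monoCount x w : ℝ) - ε
  norm : ∀ L, ∑ w, lind L w * v L w = t
  eta_nonneg : 0 ≤ η
  close : ∀ L x, |u L x - mInd x L| ≤ η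

variable {ε η : ℝ} {u : Line t → Col t → ℝ} {v : Line t → Tri t → ℝ}

/-- deviation of the rows from the line pattern -/
def Efn (u : Line t → Col t → ℝ) (L : Line t) (x : Col t) : ℝ := u L x - mInd x L
/-- deviation of the columns from the line indicators -/
def Dfn (v : Line t → Tri t → ℝ) (L : Line t) (w : Tri t) : ℝ := v L w - lind L w

/-- `|E| ≤ η` -/
lemma abs_Efn_le (h : IsLineFact t ε η u v) (L : Line t) (x : Col t) : |Efn u L x| ≤ η := h.close L x

/-- `E ≥ 0` on bichromatic lines (there the pattern is `0` and `u ≥ 0`) -/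
lemma Efn_nonneg_of_not_lmono (h : IsLineFact t ε η u v) {L : Line t} {x : Col t} (hm : ¬ lmono x L) :
    0 ≤ Efn u L x := by
  unfold Efn mInd; rw [if_neg hm, sub_zero]; exact h.u_nonneg L x

/-- `Δ ≥ 0` off the line (there `1_L = 0` and `v ≥ 0`) -/
lemma Dfn_nonneg_of_not_lmem (h : IsLineFact t ε η u v) {L : Line t} {w : Tri t} (hm : ¬ lmem L w) :
    0 ≤ Dfn v L w := by
  unfold Dfn; rw [lind_of_not_lmem hm, sub_zero]; exact h.v_nonneg L w

/-- `|Δ| = (1 − 1_L) Δ + 1_L |Δ|` (off the line `Δ ≥ 0`) -/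
lemma abs_Dfn_eq (h : IsLineFact t ε η u v) (L : Line t) (w : Tri t) :
    |Dfn v L w| = (1 - lind L w) * Dfn v L w + lind L w * |Dfn v L w| := by
  by_cases hm : lmem L w
  · rw [lind_of_lmem hm]; ring
  · rw [lind_of_not_lmem hm, abs_of_nonneg (Dfn_nonneg_of_not_lmem h hm)]; ring

/-- the on-line part of `Δ_L` has mean zero -/
lemma sum_lind_mul_Dfn (h : IsLineFact t ε η u v) (L : Line t) : ∑ w, lind L w * Dfn v L w = 0 := by
  have h1 : ∀ w, lind L w * Dfn v L w = lind L w * v L w - lind L w := by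
    intro w; unfold Dfn lind; split_ifs <;> ring
  simp only [h1, sum_sub_distrib, h.norm L, sum_lind L, sub_self]

/-- **(★)** the factorisation expanded around the line pattern -/
lemma star (h : IsLineFact t ε η u v) (x : Col t) (w : Tri t) :
    ∑ L, mInd x L * Dfn v L w + ∑ L, Efn u L x * lind L w + ∑ L, Efn u L x * Dfn v L w = -ε := by
  have hf := h.fact x w
  have h1 : ∑ L, u L x * v L w = ∑ L, (mInd x L + Efn u L x) * (lind L w + Dfn v L w) := by
    refine sum_congr rfl fun L _ => ?_; unfold Efn Dfn; ring
  have h2 : ∑ L : Line t, mInd x L * lind L w = (monoCount x w : ℝ) := by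
    rw [monoCount_eq_sum_lines]
    refine sum_congr rfl fun L _ => ?_
    unfold mInd lind
    by_cases hm : lmono x L <;> by_cases hl : lmem L w <;> simp [hm, hl]
  have h3 : ∑ L, (mInd x L + Efn u L x) * (lind L w + Dfn v L w) = ∑ L : Line t, mInd x L * lind L w
      + (∑ L, mInd x L * Dfn v L w + ∑ L, Efn u L x * lind L w + ∑ L, Efn u L x * Dfn v L w) := by
    simp only [← sum_add_distrib]; refine sum_congr rfl fun L _ => ?_; ring
  linarith [h1, h2, h3, hf]

/-! ## The averaged identity -/

/-- `A = ∑_L ∑_w ker L w · Δ_L(w)` -/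
def Aq (v : Line t → Tri t → ℝ) : ℝ := ∑ L : Line t, ∑ w : Tri t, ker L w * Dfn v L w
/-- `B = ∑_x ∑_L E_L(x) ψ^x(1_L)` -/
def Bq (u : Line t → Col t → ℝ) : ℝ := ∑ x : Col t, ∑ L : Line t, Efn u L x * ∑ w : Tri t, wt x w * lind L w
/-- `C = ∑_x ∑_L E_L(x) ψ^x(Δ_L)` -/
def Cq (u : Line t → Col t → ℝ) (v : Line t → Tri t → ℝ) : ℝ :=
  ∑ x : Col t, ∑ L : Line t, Efn u L x * ∑ w : Tri t, wt x w * Dfn v L w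
/-- `M = ∑_x μ(x)` -/
def Mq (t : ℕ) : ℝ := ∑ x : Col t, mu x

/-- `ker L w` as the `[mono]`-weighted column sum of the weights -/
lemma ker_eq_sum_mInd (L : Line t) (w : Tri t) : ker L w = ∑ x : Col t, mInd x L * wt x w := by
  unfold ker mInd
  refine sum_congr rfl fun x _ => ?_
  split_ifs <;> simp

/-- **The averaged identity** `A + B + C = −4ε M`. -/
theorem identity (h : IsLineFact t ε η u v) : Aq v + Bq u + Cq u v = -4 * ε * Mq t := by
  -- multiply (★)(x,w) by `wt x w`, sum over `w` and then over `x`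
  have hx : ∀ x : Col t, ∑ w, wt x w * (∑ L, mInd x L * Dfn v L w) + ∑ L, Efn u L x * ∑ w, wt x w * lind L w
      + ∑ L, Efn u L x * ∑ w, wt x w * Dfn v L w = -4 * ε * mu x := by
    intro x
    have h2 : ∀ f : Line t → Tri t → ℝ, ∑ w, wt x w * ∑ L, Efn u L x * f L w
        = ∑ L, Efn u L x * ∑ w, wt x w * f L w := by
      intro f
      simp only [mul_sum]
      rw [sum_comm]
      refine sum_congr rfl fun L _ => sum_congr rfl fun w _ => ?_
      ring
    rw [← h2, ← h2, ← sum_add_distrib, ← sum_add_distrib]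
    calc ∑ w, (wt x w * (∑ L, mInd x L * Dfn v L w) + wt x w * ∑ L, Efn u L x * lind L w
          + wt x w * ∑ L, Efn u L x * Dfn v L w)
        = ∑ w, wt x w * (∑ L, mInd x L * Dfn v L w + ∑ L, Efn u L x * lind L w
            + ∑ L, Efn u L x * Dfn v L w) := by
          refine sum_congr rfl fun w _ => ?_; ring
      _ = ∑ w, wt x w * (-ε) := sum_congr rfl fun w _ => by rw [star h x w]
      _ = -4 * ε * mu x := by rw [← sum_mul, sum_wt]; ring
  have hA : Aq v = ∑ x : Col t, ∑ w, wt x w * ∑ L, mInd x L * Dfn v L w := by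
    unfold Aq
    simp only [ker_eq_sum_mInd, sum_mul, mul_sum]
    calc ∑ L : Line t, ∑ w : Tri t, ∑ x : Col t, mInd x L * wt x w * Dfn v L w
        = ∑ L : Line t, ∑ x : Col t, ∑ w : Tri t, mInd x L * wt x w * Dfn v L w :=
          sum_congr rfl fun L _ => sum_comm
      _ = ∑ x : Col t, ∑ L : Line t, ∑ w : Tri t, mInd x L * wt x w * Dfn v L w := sum_comm
      _ = ∑ x : Col t, ∑ w : Tri t, ∑ L : Line t, wt x w * (mInd x L * Dfn v L w) := by
          refine sum_congr rfl fun x _ => ?_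
          rw [sum_comm]
          refine sum_congr rfl fun w _ => sum_congr rfl fun L _ => ?_
          ring
  rw [hA, Bq, Cq, Mq, ← sum_add_distrib, ← sum_add_distrib, mul_sum]
  exact sum_congr rfl fun x _ => hx x

/-! ## Bounds on `A`, `B`, `C` -/

/-- off-line mass of `Δ` -/
def Soff (v : Line t → Tri t → ℝ) : ℝ := ∑ L : Line t, ∑ w : Tri t, (1 - lind L w) * Dfn v L w
/-- on-line `ℓ¹` mass of `Δ` -/
def Son (v : Line t → Tri t → ℝ) : ℝ := ∑ L : Line t, ∑ w : Tri t, lind L w * |Dfn v L w|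
/-- `B̃ = ∑_x μ(x) ∑_{L bichromatic} E_L(x)` -/
def Bt (u : Line t → Col t → ℝ) : ℝ := ∑ x : Col t, ∑ L : Line t, (if lmono x L then 0 else Efn u L x * mu x)
/-- the kernel constant `(t−1) 2^t ((t−2) 2^t)²` -/
def Kmin (t : ℕ) : ℝ := ((t - 1 : ℕ) : ℝ) * 2 ^ t * (((t - 2 : ℕ) : ℝ) * 2 ^ t) ^ 2
/-- the one-block total of `dc`: `Fd = (t−1) 2^t / 2` -/
def Fd (t : ℕ) : ℝ := ((t - 1 : ℕ) : ℝ) * 2 ^ t / 2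

/-- `S_off ≥ 0` -/
lemma Soff_nonneg (h : IsLineFact t ε η u v) : 0 ≤ Soff v := by
  unfold Soff
  refine sum_nonneg fun L _ => sum_nonneg fun w _ => ?_
  by_cases hm : lmem L w
  · rw [lind_of_lmem hm]; simp
  · rw [lind_of_not_lmem hm]; simpa using Dfn_nonneg_of_not_lmem h hm

/-- `S_on ≥ 0` -/
lemma Son_nonneg (v : Line t → Tri t → ℝ) : 0 ≤ Son v := by
  unfold Son
  exact sum_nonneg fun L _ => sum_nonneg fun w _ => mul_nonneg (lind_nonneg L w) (abs_nonneg _)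

/-- `B̃ ≥ 0` -/
lemma Bt_nonneg (h : IsLineFact t ε η u v) : 0 ≤ Bt u := by
  unfold Bt
  refine sum_nonneg fun x _ => sum_nonneg fun L _ => ?_
  split_ifs with hm
  · exact le_rfl
  · exact mul_nonneg (Efn_nonneg_of_not_lmono h hm) (mu_nonneg x)

/-- **Bound on `A`**: the kernel is `0` on the line and `≥ Kmin/128` off it, where `Δ ≥ 0`. -/
theorem A_ge (h : IsLineFact t ε η u v) : Kmin t * Soff v ≤ 128 * Aq v := by
  unfold Soff Aq
  rw [mul_sum, mul_sum]
  refine sum_le_sum fun L _ => ?_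
  rw [mul_sum, mul_sum]
  refine sum_le_sum fun w _ => ?_
  by_cases hm : lmem L w
  · rw [lind_of_lmem hm, ker_eq_zero_of_lmem hm]; simp
  · rw [lind_of_not_lmem hm]
    have hk := ker_ge_of_not_lmem hm
    have hD := Dfn_nonneg_of_not_lmem h hm
    calc Kmin t * ((1 - 0) * Dfn v L w) = Kmin t * Dfn v L w := by ring
      _ ≤ (128 * ker L w) * Dfn v L w := mul_le_mul_of_nonneg_right hk hD
      _ = 128 * (ker L w * Dfn v L w) := by ring

/-- **Bounds on `B`**: `0 ≤ B` and `2 B̃ ≤ t² B`. -/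
theorem B_ge (h : IsLineFact t ε η u v) : 0 ≤ Bq u ∧ 2 * Bt u ≤ (t : ℝ) ^ 2 * Bq u := by
  have key : ∀ x L, 0 ≤ Efn u L x * ∑ w : Tri t, wt x w * lind L w ∧
      2 * (if lmono x L then 0 else Efn u L x * mu x) ≤ (t : ℝ) ^ 2 * (Efn u L x * ∑ w : Tri t, wt x w * lind L w) := by
    intro x L
    by_cases hm : lmono x L
    · rw [psi_lind_mono x hm, if_pos hm]; simp
    · have hE := Efn_nonneg_of_not_lmono h hm
      refine ⟨mul_nonneg hE (psi_lind_nonneg x L), ?_⟩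
      rw [if_neg hm]
      have := psi_lind_bichro x hm
      calc 2 * (Efn u L x * mu x) = Efn u L x * (2 * mu x) := by ring
        _ ≤ Efn u L x * ((t : ℝ) ^ 2 * ∑ w : Tri t, wt x w * lind L w) := mul_le_mul_of_nonneg_left this hE
        _ = (t : ℝ) ^ 2 * (Efn u L x * ∑ w : Tri t, wt x w * lind L w) := by ring
  constructor
  · exact sum_nonneg fun x _ => sum_nonneg fun L _ => (key x L).1
  · unfold Bt Bq
    rw [mul_sum, mul_sum]
    refine sum_le_sum fun x _ => ?_
    rw [mul_sum, mul_sum]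
    exact sum_le_sum fun L _ => (key x L).2

/-- a sum over colourings of a product of one-block functions factorises -/
lemma sum_col_mul (f g k : (Fin t → Bool) → ℝ) :
    ∑ x : Col t, f x.1 * g x.2.1 * k x.2.2 = (∑ y, f y) * (∑ y, g y) * (∑ y, k y) := by
  rw [Fintype.sum_prod_type, sum_mul_sum, sum_mul]
  refine sum_congr rfl fun a _ => ?_
  rw [Fintype.sum_prod_type, sum_mul_sum]

/-- the column sums of the unsigned weights: `∑_x dc₀ dc₁ dc₂ = Fd³` -/
lemma sum_nw_col (w : Tri t) : ∑ x : Col t, nw x w = Fd t ^ 3 := by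
  have hF : ∀ v₀ : Fin t, ∑ y : Fin t → Bool, (dc y v₀ : ℝ) = Fd t := by
    intro v₀
    have := two_mul_sum_dc (t := t) v₀
    unfold Fd
    have h' : (2 : ℝ) * ∑ y : Fin t → Bool, (dc y v₀ : ℝ) = ((t - 1 : ℕ) : ℝ) * 2 ^ t := by exact_mod_cast this
    linarith
  unfold nw
  rw [sum_col_mul (fun y => (dc y w.1 : ℝ)) (fun y => (dc y w.2.1 : ℝ)) (fun y => (dc y w.2.2 : ℝ)), hF, hF, hF]
  ring

/-- **Bound on `C`**: `|C| ≤ η · Fd³ · (S_off + S_on)`. -/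
theorem C_le (h : IsLineFact t ε η u v) : |Cq u v| ≤ η * Fd t ^ 3 * (Soff v + Son v) := by
  have hη := h.eta_nonneg
  have hsum : Soff v + Son v = ∑ L : Line t, ∑ w : Tri t, |Dfn v L w| := by
    unfold Soff Son
    rw [← sum_add_distrib]
    refine sum_congr rfl fun L _ => ?_
    rw [← sum_add_distrib]
    exact sum_congr rfl fun w _ => (abs_Dfn_eq h L w).symm
  calc |Cq u v| ≤ ∑ x : Col t, |∑ L : Line t, Efn u L x * ∑ w : Tri t, wt x w * Dfn v L w| :=
        abs_sum_le_sum_abs _ _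
    _ ≤ ∑ x : Col t, ∑ L : Line t, |Efn u L x * ∑ w : Tri t, wt x w * Dfn v L w| :=
        sum_le_sum fun x _ => abs_sum_le_sum_abs _ _
    _ ≤ ∑ x : Col t, ∑ L : Line t, η * ∑ w : Tri t, nw x w * |Dfn v L w| := by
        refine sum_le_sum fun x _ => sum_le_sum fun L _ => ?_
        rw [abs_mul]
        refine mul_le_mul (h.close L x) ?_ (abs_nonneg _) hη
        calc |∑ w : Tri t, wt x w * Dfn v L w| ≤ ∑ w : Tri t, |wt x w * Dfn v L w| := abs_sum_le_sum_abs _ _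
          _ ≤ ∑ w : Tri t, nw x w * |Dfn v L w| := sum_le_sum fun w _ => by
              rw [abs_mul]; exact mul_le_mul_of_nonneg_right (abs_wt_le x w) (abs_nonneg _)
    _ = η * ∑ L : Line t, ∑ w : Tri t, (∑ x : Col t, nw x w) * |Dfn v L w| := by
        simp only [mul_sum, sum_mul]
        exact sum_comm.trans (sum_congr rfl fun L _ => sum_comm)
    _ = η * Fd t ^ 3 * (Soff v + Son v) := by
        simp only [sum_nw_col]
        rw [hsum]
        simp only [mul_sum]
        refine sum_congr rfl fun L _ => sum_congr rfl fun w _ => ?_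
        ring

/-! ## The block total and the mass `M` -/

/-- the one-block total `T = ∑_y cp y` -/
def Tcp (t : ℕ) : ℝ := ∑ y : Fin t → Bool, (cp y : ℝ)

/-- `4 T = t (t−1) 2^t` -/
lemma four_mul_Tcp (t : ℕ) : 4 * Tcp t = t * ((t - 1 : ℕ) : ℝ) * 2 ^ t := by
  unfold Tcp; exact_mod_cast four_mul_sum_cp (t := t)

/-- `M = T³` (the three blocks are independent) -/
lemma Mq_eq (t : ℕ) : Mq t = Tcp t ^ 3 := by
  unfold Mq mu Tcp
  rw [sum_col_mul (fun y => (cp y : ℝ)) (fun y => (cp y : ℝ)) (fun y => (cp y : ℝ))]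
  ring

/-! ## The unique monochromatic line through an off point -/

/-- two monochromatic lines through a `1`-mono triangle coincide -/
lemma eq_of_lmono_of_lmem {x : Col t} {w : Tri t} (hoff : ¬ IsMono x w.1 w.2.1 w.2.2) {L L' : Line t}
    (hL : lmem L w) (hm : lmono x L) (hL' : lmem L' w) (hm' : lmono x L') : L' = L := by
  obtain ⟨a, b, d⟩ := w
  simp only [IsMono] at hoff
  rcases L with ⟨a₁, b₁⟩ | ⟨a₁, d₁⟩ | ⟨b₁, d₁⟩ <;> rcases L' with ⟨a₂, b₂⟩ | ⟨a₂, d₂⟩ | ⟨b₂, d₂⟩ <;>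
    simp only [lmem_inl, lmem_inr_inl, lmem_inr_inr, lmono_inl, lmono_inr_inl, lmono_inr_inr] at hL hL' hm hm' <;>
    obtain ⟨rfl, rfl⟩ := hL <;> obtain ⟨rfl, rfl⟩ := hL'
  · rfl
  · exact (hoff ⟨hm, hm'⟩).elim
  · exact (hoff ⟨hm, hm.trans hm'⟩).elim
  · exact (hoff ⟨hm', hm⟩).elim
  · rfl
  · exact (hoff ⟨hm.trans hm'.symm, hm⟩).elim
  · exact (hoff ⟨hm', hm'.trans hm⟩).elim
  · exact (hoff ⟨hm'.trans hm.symm, hm'⟩).elim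
  · rfl

/-- summing over the monochromatic lines through an off point picks out the one line -/
lemma sum_mInd_lind_eq {x : Col t} {w : Tri t} (hoff : ¬ IsMono x w.1 w.2.1 w.2.2) {L : Line t}
    (hL : lmem L w) (hm : lmono x L) (f : Line t → ℝ) :
    ∑ L', mInd x L' * lind L' w * f L' = f L := by
  rw [Fintype.sum_eq_single L]
  · unfold mInd lind; rw [if_pos hm, if_pos hL]; ring
  · intro L' hne
    unfold mInd lind
    by_cases hm' : lmono x L'
    · rw [if_neg (fun hL' => hne (eq_of_lmono_of_lmem hoff hL hm hL' hm'))]; ring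
    · rw [if_neg hm']; ring


/-- **The line factorisation of the triangle matrix** — registered sub-goal `triangle_line_factorisation` of
stmt-PneNP-10680, verbatim signature (see `monoCount_eq_sum_lines`): the number of monochromatic edges of the triangle
`w` equals the number of monochromatic lines through `w`, summed direction by direction. -/
theorem triangle_line_factorisation : ∀ (t : ℕ) (x : (Fin t → Bool) × (Fin t → Bool) × (Fin t → Bool)) (w : Fin t ×
    Fin t × Fin t), ((if x.1 w.1 = x.2.1 w.2.1 then 1 else 0) + (if x.1 w.1 = x.2.2 w.2.2 then 1 else 0) + (if x.2.1
    w.2.1 = x.2.2 w.2.2 then 1 else 0) : ℝ) = (∑ ab : Fin t × Fin t, if x.1 ab.1 = x.2.1 ab.2 ∧ (w.1 = ab.1 ∧ w.2.1 =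
    ab.2) then (1 : ℝ) else 0) + (∑ ad : Fin t × Fin t, if x.1 ad.1 = x.2.2 ad.2 ∧ (w.1 = ad.1 ∧ w.2.2 = ad.2) then (1 :
    ℝ) else 0) + ∑ bd : Fin t × Fin t, if x.2.1 bd.1 = x.2.2 bd.2 ∧ (w.2.1 = bd.1 ∧ w.2.2 = bd.2) then (1 : ℝ) else 0
    := by
  intro t x w
  have h := monoCount_eq_sum_lines x w
  rw [Fintype.sum_sum_type, Fintype.sum_sum_type] at h
  simp only [lmono_inl, lmono_inr_inl, lmono_inr_inr, lmem_inl, lmem_inr_inl, lmem_inr_inr, monoCount] at h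
  push_cast at h
  linarith

end

end Summit.PneNP.PneNP.Theorems.XorDoor.TriLine
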